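import Literature.Computability.Complexity.TokenStreams
import HarnessLib

/-!
# Generator programs with two input counters

Sequel of `GenPrograms.lean` / `TokenStreams.lean` (trunk `CplxCore`, toolkit for uniformity
proofs: nested counted loops with polynomial bounds generate descriptions in polynomial time;
Arora–Barak 2009, §6.2 and proof of Thm. 6.15, "output the description gate by gate, keeping
counters"). There the generated stream depends on the input only through one counter, the
input *length*. Descriptions of circuit families sometimes involve a second quantity that is
polynomial-time but not a polynomial of the length — e.g. a number of bits `⌈log₂ m(n)⌉`
(Raz–Tal's `BQP^O` machine reads a window addressed by `n + 1 + size(m(n))` bits,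
`OracleSeparationBQPPH.rtLen`). This file adds a two-counter front end: the input is parsed as
`1ᵃ 0 w` and the generator is started with `x₀ = a`, `x₁ = |w|`.

* `parseEnv` — the environment after parsing (each leading `1` increments `x₀`, at the first `0`
  the length of the rest is added to `x₁`); `parseEnv_replicate` — on `1ᵃ 0 w` from the zero
  environment it is `x₀ ↦ a, x₁ ↦ |w|`;
* `parse₂` — the parsing stack program (`StackPrograms.lean`), `runs_parse₂`;
* `progC₂`, `progC₂_runs` — parse, run the compiled statement (`GenProg.stmtC_runs`), pour out;
* **`GStmt.out₂_mem_FP`** — the coded stream `z ↦ code (out s (parseEnv z))` is in `FP`;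
  **`GStmt.render_out₂_mem_FP`** — over the token alphabet, the rendered stream (binary
  numerals of unary-counted quantities, `TokenStreams.lean`) is in `FP`.

So a uniformity proof with two counters again reduces to a list identity, plus an `FP`
preprocessor `1ⁿ ↦ 1ⁿ 0 w(n)` with `|w(n)|` the second quantity (for a binary length: a
one-counter generator printing `1ⁿ 0` and the numeral of `m(n)`, `GStmt.render_out_mem_FP`).

## References

* S. Arora, B. Barak, *Computational Complexity: A Modern Approach*, CUP 2009, §1.3
  (robustness of polynomial time), §6.2 and Thm. 6.15 (uniformly generated circuit families).
* T. Nipkow, G. Klein, *Concrete Semantics with Isabelle/HOL*, Springer 2014, Ch. 7–8.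
-/

namespace Literature.Computability.Complexity

open _root_.Computability Polynomial

namespace GenProg

variable {V Γ : Type} [DecidableEq V] {D : ℕ}

/-! ### Parsing `1ᵃ 0 w` -/

/-- **The environment after parsing `z` from `env`**: every leading `1` increments `x₀`; at the
first `0` the length of the rest is added to `x₁`. [folklore] -/
def parseEnv (x₀ x₁ : V) : (V → ℕ) → List Bool → (V → ℕ)
  | env, true :: z => parseEnv x₀ x₁ (Function.update env x₀ (env x₀ + 1)) z
  | env, false :: z => Function.update env x₁ (env x₁ + z.length)
  | env, [] => env

/-- The two-counter environment `x₀ ↦ a`, `x₁ ↦ b`, all others `0`. [folklore] -/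
def initEnv₂ (x₀ x₁ : V) (a b : ℕ) : V → ℕ := Function.update (Function.update (fun _ => 0) x₁ b) x₀ a

/-- **Parsing `1ᵃ 0 w` from the zero environment gives `x₀ ↦ a`, `x₁ ↦ |w|`.** [folklore] -/
theorem parseEnv_replicate {x₀ x₁ : V} (h : x₀ ≠ x₁) (a : ℕ) (w : List Bool) :
    parseEnv x₀ x₁ (fun _ => 0) (List.replicate a true ++ false :: w) = initEnv₂ x₀ x₁ a w.length := by
  suffices key : ∀ (a c : ℕ), parseEnv x₀ x₁ (Function.update (fun _ => 0) x₀ c) (List.replicate a true ++ false :: w) =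
      initEnv₂ x₀ x₁ (c + a) w.length by
    have := key a 0
    simp only [Nat.zero_add] at this
    rw [← this]
    congr 1
    funext y; simp
  intro a
  induction a with
  | zero =>
    intro c
    rw [List.replicate_zero, List.nil_append, parseEnv, Function.update_of_ne h.symm, initEnv₂]
    funext y
    rcases eq_or_ne y x₀ with rfl | hy
    · rw [Function.update_of_ne h, Function.update_self, Function.update_self]; rfl
    · rw [Function.update_of_ne hy]
      rcases eq_or_ne y x₁ with rfl | hy'
      · simp
      · simp [Function.update_of_ne hy, Function.update_of_ne hy']
  | succ a ih =>
    intro c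
    rw [List.replicate_succ, List.cons_append, parseEnv, Function.update_self, Function.update_idem, ih (c + 1)]
    congr 1; omega

/-- Parsed values are bounded by the start values plus the input length. [folklore] -/
theorem parseEnv_le {x₀ x₁ : V} : ∀ (env : V → ℕ) (z : List Bool) (U : ℕ), (∀ y, env y ≤ U) →
    ∀ y, parseEnv x₀ x₁ env z y ≤ U + z.length
  | env, [], U, hU, y => by rw [parseEnv]; exact (hU y).trans (Nat.le_add_right _ _)
  | env, true :: z, U, hU, y => by
    rw [parseEnv]
    have := parseEnv_le (x₀ := x₀) (x₁ := x₁) (Function.update env x₀ (env x₀ + 1)) z (U + 1) (fun y' => by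
      rcases eq_or_ne y' x₀ with rfl | hy
      · rw [Function.update_self]; exact Nat.succ_le_succ (hU _)
      · rw [Function.update_of_ne hy]; exact (hU y').trans (Nat.le_succ _)) y
    simp only [List.length_cons]; omega
  | env, false :: z, U, hU, y => by
    rw [parseEnv]
    rcases eq_or_ne y x₁ with rfl | hy
    · rw [Function.update_self]; have := hU y; simp; omega
    · rw [Function.update_of_ne hy]; exact (hU y).trans (Nat.le_add_right _ _)

/-- Variables other than `x₀`, `x₁` keep their value. [folklore] -/
theorem parseEnv_of_ne {x₀ x₁ : V} : ∀ (env : V → ℕ) (z : List Bool) {y : V}, y ≠ x₀ → y ≠ x₁ →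
    parseEnv x₀ x₁ env z y = env y
  | env, [], y, _, _ => rfl
  | env, true :: z, y, h0, h1 => by
    rw [parseEnv, parseEnv_of_ne _ z h0 h1, Function.update_of_ne h0]
  | env, false :: z, y, _, h1 => by rw [parseEnv, Function.update_of_ne h1]

/-! ### The parsing program -/

/-- Count every remaining input symbol into `x₁`. [folklore] -/
abbrev countAll (x₁ : V) : Com (GReg V D) := loopC GReg.inp (Com.push (GReg.main x₁) true)

/-- **The parser**: pop the input; a `1` increments `x₀`; at the first `0`, count the rest into `x₁`.
[folklore] -/
def parse₂ (x₀ x₁ : V) : Com (GReg V D) :=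
  Com.loop GReg.inp (Com.push (GReg.main x₀) true) (countAll x₁)

/-- Incrementing a unary main register. [folklore] -/
theorem update_mk_main_succ (env : V → ℕ) (x : V) (cs : ℕ → List Bool) (t o r i : List Bool) :
    Function.update (mk (unary env) cs t o r i : Regs (GReg V D)) (GReg.main x)
      (true :: (mk (unary env) cs t o r i : Regs (GReg V D)) (GReg.main x)) =
      mk (unary (Function.update env x (env x + 1))) cs t o r i := by
  rw [update_mk_main, mk_main]
  congr 1
  rw [unary_update]
  simp [List.replicate_succ]

/-- `countAll` adds the input length to `x₁`. [folklore] -/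
theorem runs_countAll (x₁ : V) (cs : ℕ → List Bool) (t o r : List Bool) :
    ∀ (w : List Bool) (env : V → ℕ),
    Com.Runs (countAll x₁ : Com (GReg V D)) (mk (unary env) cs t o r w)
      (mk (unary (Function.update env x₁ (env x₁ + w.length))) cs t o r []) (3 * w.length + 1)
  | [], env => by
    have e : Function.update env x₁ (env x₁ + ([] : List Bool).length) = env := by simp
    rw [e]
    simpa using Com.Runs.loop_nil (R := (mk (unary env) cs t o r [] : Regs (GReg V D)))
      (Com.push (GReg.main x₁) true) (Com.push (GReg.main x₁) true) rfl
  | b :: w, env => by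
    have h1 := Com.Runs.push (GReg.main x₁) true (mk (unary env) cs t o r w : Regs (GReg V D))
    rw [update_mk_main_succ] at h1
    have ih := runs_countAll x₁ cs t o r w (Function.update env x₁ (env x₁ + 1))
    rw [Function.update_idem, Function.update_self,
      show env x₁ + 1 + w.length = env x₁ + (b :: w).length by simp; omega] at ih
    have hk : (mk (unary env) cs t o r (b :: w) : Regs (GReg V D)) GReg.inp = b :: w := rfl
    cases b
    · exact (Com.Runs.loop_false hk (by rw [update_mk_inp]; exact h1) ih).mono (by simp; omega)
    · exact (Com.Runs.loop_true hk (by rw [update_mk_inp]; exact h1) ih).mono (by simp; omega)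

/-- **The parser computes `parseEnv`.** [folklore] -/
theorem runs_parse₂ (x₀ x₁ : V) (cs : ℕ → List Bool) (t o r : List Bool) :
    ∀ (w : List Bool) (env : V → ℕ),
    Com.Runs (parse₂ x₀ x₁ : Com (GReg V D)) (mk (unary env) cs t o r w)
      (mk (unary (parseEnv x₀ x₁ env w)) cs t o r []) (3 * w.length + 4)
  | [], env => by
    exact (Com.Runs.loop_nil (R := (mk (unary env) cs t o r [] : Regs (GReg V D)))
      (Com.push (GReg.main x₀) true) (countAll x₁) (k := GReg.inp) rfl).mono (by omega)
  | true :: w, env => by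
    have h1 := Com.Runs.push (GReg.main x₀) true (mk (unary env) cs t o r w : Regs (GReg V D))
    rw [update_mk_main_succ] at h1
    have ih := runs_parse₂ x₀ x₁ cs t o r w (Function.update env x₀ (env x₀ + 1))
    have hk : (mk (unary env) cs t o r (true :: w) : Regs (GReg V D)) GReg.inp = true :: w := rfl
    exact (Com.Runs.loop_true hk (by rw [update_mk_inp]; exact h1) ih).mono (by simp; omega)
  | false :: w, env => by
    have h1 := runs_countAll (D := D) x₁ cs t o r w env
    have hk : (mk (unary env) cs t o r (false :: w) : Regs (GReg V D)) GReg.inp = false :: w := rfl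
    have h2 := Com.Runs.loop_nil (R := (mk (unary (Function.update env x₁ (env x₁ + w.length))) cs t o r [] : Regs (GReg V D)))
      (Com.push (GReg.main x₀) true) (countAll x₁) (k := GReg.inp) rfl
    exact (Com.Runs.loop_false hk (by rw [update_mk_inp]; exact h1) h2).mono (by simp)

/-! ### The whole program -/

variable (code : Γ → List Bool)

/-- **The two-counter compiled generator**: parse, run the statement, pour out. [folklore] -/
def progC₂ (x₀ x₁ : V) (s : GStmt V Γ) : Com (GReg V D) :=
  parse₂ x₀ x₁ ;; stmtC code s 0 ;; Com.loop GReg.out (Com.push GReg.res true) (Com.push GReg.res false)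

/-- The initial register file is `mk` of the zero environment (`GenPrograms.init_eq` with
`initEnv x₀ 0 = 0`). [folklore] -/
theorem init_eq_zero (x₀ : V) (z : List Bool) :
    (Regs.init GReg.inp z : Regs (GReg V D)) = mk (unary fun _ => 0) (fun _ => []) [] [] [] z := by
  rw [init_eq z x₀, initEnv, Function.update_eq_self]

/-- **The whole run**: on input `z`, the two-counter generator leaves the coded stream of
`out s (parseEnv z)` in the result register. [folklore] -/
theorem progC₂_runs (x₀ x₁ : V) (s : GStmt V Γ) (h0 : x₀ ∉ s.loopVars) (h1 : x₁ ∉ s.loopVars)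
    (hs : s.noReuse = true) (hD : s.depth ≤ D) (z : List Bool) :
    Com.Runs (progC₂ code x₀ x₁ s : Com (GReg V D)) (Regs.init GReg.inp z)
      (mk (unary (parseEnv x₀ x₁ (fun _ => 0) z)) (fun _ => []) [] []
        ((s.out (parseEnv x₀ x₁ (fun _ => 0) z)).flatMap code) [])
      (3 * z.length + 4 + s.cost code (parseEnv x₀ x₁ (fun _ => 0) z) +
        (3 * s.cost code (parseEnv x₀ x₁ (fun _ => 0) z) + 1)) := by
  rw [init_eq_zero x₀ z]
  have hp := runs_parse₂ (D := D) x₀ x₁ (fun _ => []) [] [] [] z (fun _ => 0)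
  have h2 := stmtC_runs (D := D) code s hs (φ := 0) (by omega) (parseEnv x₀ x₁ (fun _ => 0) z)
    (fun j hj => parseEnv_of_ne _ z (fun h => h0 (h ▸ hj)) (fun h => h1 (h ▸ hj))) (fun _ => []) (fun _ _ => rfl) [] [] []
  have h3 := runs_pour (D := D) (unary (parseEnv x₀ x₁ (fun _ => 0) z)) (fun _ => []) [] []
    (((s.out (parseEnv x₀ x₁ (fun _ => 0) z)).flatMap code).reverse ++ []) []
  simp only [List.append_nil, List.reverse_reverse, List.length_reverse] at h2 h3
  exact (hp.seq (h2.seq h3)).mono (by have := s.length_out_le code (parseEnv x₀ x₁ (fun _ => 0) z); omega)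

end GenProg

/-! ### Polynomial time -/

namespace GStmt

variable {V Γ : Type} [DecidableEq V] [Fintype V]

/-- **Two-counter generator programs produce `FP` streams**: the coded stream of
`out s (parseEnv z)` (input parsed as `1ᵃ 0 w`: `x₀ ↦ a`, `x₁ ↦ |w|`) is a polynomial-time
function of `z`. [Arora–Barak 2009, proof of Thm. 6.15; Nipkow–Klein 2014, Ch. 8] [folklore] -/
theorem out₂_mem_FP (code : Γ → List Bool) (s : GStmt V Γ) (x₀ x₁ : V) (h0 : x₀ ∉ s.loopVars)
    (h1 : x₁ ∉ s.loopVars) (hs : s.noReuse = true) :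
    (fun z => (s.out (GenProg.parseEnv x₀ x₁ (fun _ => 0) z)).flatMap code) ∈ FP := by
  refine Com.mem_FP (ι := GReg V s.depth) (GenProg.progC₂ code x₀ x₁ s) GReg.inp GReg.res
    (3 * X + 4 * s.cpoly code + 5) _ fun z =>
      ⟨GenProg.mk (GenProg.unary (GenProg.parseEnv x₀ x₁ (fun _ => 0) z)) (fun _ => []) [] []
        ((s.out (GenProg.parseEnv x₀ x₁ (fun _ => 0) z)).flatMap code) [], Or.inl ?_, rfl⟩
  refine (GenProg.progC₂_runs code x₀ x₁ s h0 h1 hs le_rfl z).mono ?_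
  have hle : ∀ y, GenProg.parseEnv x₀ x₁ (fun _ => 0) z y ≤ z.length := fun y => by
    simpa using GenProg.parseEnv_le (x₀ := x₀) (x₁ := x₁) (fun _ => 0) z 0 (fun _ => le_rfl) y
  have := s.cost_le code hle
  simp only [eval_add, eval_mul, eval_ofNat, eval_X]
  omega

/-- **Two-counter generator programs print rendered descriptions in polynomial time.** For a
generator program over the token alphabet (loop indices avoiding `x₀`, `x₁`, not reused), the
rendered stream `z ↦ render 0 (out s (parseEnv z))` is in `FP`. [Arora–Barak 2009, §6.2 and
proof of Thm. 6.15] [folklore] -/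
theorem render_out₂_mem_FP (s : GStmt V Tok) (x₀ x₁ : V) (h0 : x₀ ∉ s.loopVars) (h1 : x₁ ∉ s.loopVars)
    (hs : s.noReuse = true) :
    (fun z => Tok.render 0 (s.out (GenProg.parseEnv x₀ x₁ (fun _ => 0) z))) ∈ FP := by
  have hf := s.out₂_mem_FP Tok.code x₀ x₁ h0 h1 hs
  have h2 := PolyTimeComputable.comp_holds Tok.render_decode_mem_FP hf
  have e : ((fun z : List Bool => Tok.render 0 (Tok.decode z)) ∘ fun z : List Bool =>
      (s.out (GenProg.parseEnv x₀ x₁ (fun _ => 0) z)).flatMap Tok.code) =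
      fun z : List Bool => Tok.render 0 (s.out (GenProg.parseEnv x₀ x₁ (fun _ => 0) z)) := by
    funext z; simp [Tok.decode_code]
  rw [e] at h2
  exact h2

end GStmt

end Literature.Computability.Complexity
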